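import Literature.NumberTheory.EllipticCurves.Shintani32Kernel
import HarnessLib

/-!
# Kohnen's genus weight on the full level-`32` lattice `{[32a, b, c]}`

[[cite: Shintani1975, §2]] — the weight of the theta kernel that lifts the level-`32` newform into
Tunnell's space `S_{3/2}(128, 1)` WITH an informative diagonal (route to Waldspurger's corollary at
level `128` and `Literature.NumberTheory.EllipticCurves.Tunnell1983_a_sq_propto_L_one`).  In contrast
with `Shintani32GenusSymbols`/`Shintani32Kernel` (weight supported on the sublattice `64 ∣ k₁`, genus
character of `-8D`), here the weight lives on ALL coordinates `k ∈ ℤ³` of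
`L♮₃₂ = {Q_k = [32k₀, k₁, k₂]}` (`latSharp32 k = (32k₀, k₁, k₂)`), through the FULL discriminant
`Δ(k) = k₁² - 128 k₀ k₂ = disc (latSharp32 k)` — Kohnen's lattice of level `4 · 32 = 128`
(W. Kohnen, Math. Ann. 271 (1985), §1; B. Gross, W. Kohnen, D. Zagier, Math. Ann. 278 (1987), §I.2,
the genus character `χ_D(Q)` on forms of discriminant divisible by `D`):

* `discK k = k₁² - 128k₀k₂`, `binValK k s t = 32k₀s² + k₁st + k₂t²` (the values of `Q_k`),
  `128 k₀ · Q_k(s,t) = (64k₀s + k₁t)² - Δ(k) t²` (`mul_binValK_eq`);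
* the local symbol `kohnenSym p k` (`0` unless `p ∣ Δ(k)`; then `(k₂/p)` if `p ∣ k₀`, else
  `(2k₀/p)`) — the Legendre symbol of ANY value of `Q_k` prime to `p`
  (`kohnenSym_eq_jacobiSym_binValK`, Lemmas A/B), hence **`Γ₀(32)`-invariant**
  (`kohnenSym_actSharp32`, `actSharp32 = Q ↦ Q ∘ (a b; 32c' d)`);
* the weight `kohnenWt D k = ∏_{p ∣ D} kohnenSym p k` (the generalized genus character `χ_{D*}(Q_k)`,
  `D* = (-1/D)·D`), its invariance (`invWeight32_kohnenWt`), boundedness (`bddWeight_kohnenWt`),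
  support `D ∣ Δ(k)` (`kohnenWt_of_not_dvd`), periodicity modulo multiples of `D`
  (`kohnenWt_congr`), scaling `kohnenWt (t • k) = (t/D) · kohnenWt k` (`kohnenWt_smul`), parity
  `kohnenWt (-k) = (-1/D) kohnenWt k` (`kohnenWt_neg`; so the weight is odd exactly for
  `D ≡ 3 (mod 4)`, where the kernel is non-zero — numerically `θ`-automorphic of level `128` with
  trivial character), and the bridge to the sublattice weight `kohnenSym p (embed32 v) = coneSym32 p v`.

No named facts.
-/

namespace Literature.NumberTheory.EllipticCurves.Shintani

open Finset

/-! ### The discriminant and the values of `Q_k = [32k₀, k₁, k₂]` -/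

/-- The full discriminant `Δ(k) = k₁² - 128 k₀ k₂` of `Q_k = [32k₀, k₁, k₂]`. [folklore] -/
def discK (k : Fin 3 → ℤ) : ℤ := k 1 ^ 2 - 128 * k 0 * k 2

/-- The values `Q_k(s, t) = 32k₀s² + k₁st + k₂t²`. [folklore] -/
def binValK (k : Fin 3 → ℤ) (s t : ℤ) : ℤ := 32 * k 0 * s ^ 2 + k 1 * s * t + k 2 * t ^ 2

/-- `Δ(k)` is the real discriminant of `ι♮₃₂(k)`. [folklore] -/
theorem disc_latSharp32_eq_discK (k : Fin 3 → ℤ) : disc (latSharp32 k) = (discK k : ℝ) := by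
  rw [disc_latSharp32, discK]

/-- Completing the square: `128 k₀ · Q_k(s,t) = (64k₀s + k₁t)² - Δ(k) t²`. [folklore] -/
theorem mul_binValK_eq (k : Fin 3 → ℤ) (s t : ℤ) :
    128 * k 0 * binValK k s t = (64 * k 0 * s + k 1 * t) ^ 2 - discK k * t ^ 2 := by
  simp only [binValK, discK]; ring

/-- `Δ(Q ∘ g) = Δ(Q)` for `g = (a b; 32c' d) ∈ SL₂(ℤ)`. [folklore] -/
theorem discK_actSharp32 {a b c' d : ℤ} (hdet : a * d - 32 * b * c' = 1) (k : Fin 3 → ℤ) :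
    discK (actSharp32 a b c' d k) = discK k := by
  have : discK (actSharp32 a b c' d k) = (a * d - 32 * b * c') ^ 2 * discK k := by
    simp only [discK, actSharp32]; simp; ring
  rw [this, hdet, one_pow, one_mul]

/-- `Δ(-k) = Δ(k)`. [folklore] -/
theorem discK_neg (k : Fin 3 → ℤ) : discK (-k) = discK k := by
  simp only [discK, Pi.neg_apply]; ring

/-- `Δ(t k) = t² Δ(k)`. [folklore] -/
theorem discK_smul (t : ℤ) (k : Fin 3 → ℤ) : discK (t • k) = t ^ 2 * discK k := by
  simp only [discK, Pi.smul_apply, smul_eq_mul]; ring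

/-- `Δ` respects congruences. [folklore] -/
theorem discK_emod_congr {M : ℤ} {k u : Fin 3 → ℤ} (h : ∀ i, k i ≡ u i [ZMOD M]) :
    discK k ≡ discK u [ZMOD M] := by
  unfold discK
  exact ((h 1).pow 2).sub (((Int.ModEq.refl 128).mul (h 0)).mul (h 2))

/-- On the sublattice `64 ∣ k₁`: `Δ(embed₃₂ v) = 128 n₃₂(v)`. [folklore] -/
theorem discK_embed32 (v : Fin 3 → ℤ) : discK (embed32 v) = 128 * nQ32 v := by
  simp only [discK, embed32, nQ32]; simp; ring

/-- The first coordinate of `Q ∘ g`: `32 (Q∘g)₀ = Q(a, 32c')`. [folklore] -/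
theorem actSharp32_zero_eq (a b c' d : ℤ) (k : Fin 3 → ℤ) :
    32 * actSharp32 a b c' d k 0 = binValK k a (32 * c') := by
  simp only [actSharp32, binValK]; simp; ring

/-- The last coordinate of `Q ∘ g`: `(Q∘g)₂ = Q(b, d)`. [folklore] -/
theorem actSharp32_two_eq (a b c' d : ℤ) (k : Fin 3 → ℤ) : actSharp32 a b c' d k 2 = binValK k b d := by
  simp only [actSharp32, binValK]; simp

/-! ### The local symbol -/

/-- **Kohnen's local genus symbol** at a prime `p`: `0` unless `p ∣ Δ(k)`; then `(k₂/p)` if `p ∣ k₀`,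
else `(2k₀/p)` (`= (128k₀/p)`, the symbol of the leading coefficient after completing the square).
[folklore] -/
def kohnenSym (p : ℕ) (k : Fin 3 → ℤ) : ℤ :=
  if (p : ℤ) ∣ discK k then (if (p : ℤ) ∣ k 0 then jacobiSym (k 2) p else jacobiSym (2 * k 0) p) else 0

/-- `kohnenSym_of_not_dvd` (auxiliary). [folklore] -/
theorem kohnenSym_of_not_dvd {p : ℕ} {k : Fin 3 → ℤ} (h : ¬ (p : ℤ) ∣ discK k) : kohnenSym p k = 0 := by
  simp [kohnenSym, h]

/-- `|kohnenSym p k| ≤ 1`. [folklore] -/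
theorem abs_kohnenSym_le (p : ℕ) (k : Fin 3 → ℤ) : |kohnenSym p k| ≤ 1 := by
  unfold kohnenSym
  have htri : ∀ a : ℤ, |jacobiSym a p| ≤ 1 := fun a ↦ by
    rcases jacobiSym.trichotomy a p with h | h | h <;> simp [h]
  split_ifs <;> first | exact htri _ | simp

/-- **Bridge to the sublattice symbol**: `kohnenSym p (embed₃₂ v) = Ω_p(v)` (`coneSym32`) for odd `p`.
[folklore] -/
theorem kohnenSym_embed32 {p : ℕ} (hp : p.Prime) (hp2 : p ≠ 2) (v : Fin 3 → ℤ) :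
    kohnenSym p (embed32 v) = coneSym32 p v := by
  have hp' : Prime (p : ℤ) := Nat.prime_iff_prime_int.mp hp
  have h128 : ¬ (p : ℤ) ∣ 128 := by
    intro h
    have h2 : (p : ℤ) ∣ 2 := hp'.dvd_of_dvd_pow (show (p : ℤ) ∣ 2 ^ 7 by norm_num; exact h)
    have : p ∣ 2 := by exact_mod_cast h2
    exact hp2 ((Nat.prime_dvd_prime_iff_eq hp Nat.prime_two).mp this)
  have hiff : (p : ℤ) ∣ discK (embed32 v) ↔ (p : ℤ) ∣ nQ32 v := by
    rw [discK_embed32]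
    constructor
    · intro h
      rcases hp'.dvd_or_dvd h with h | h
      · exact absurd h h128
      · exact h
    · exact fun h ↦ dvd_mul_of_dvd_right h _
  unfold kohnenSym coneSym32
  simp only [hiff, embed32_zero, embed32_two]

section ConeLemmas

variable {p : ℕ} [hp : Fact p.Prime]

/-- `128 ≠ 0` in `ZMod p` for odd `p` (auxiliary). [folklore] -/
theorem c128_ne_zero_zmod (hp2 : p ≠ 2) : (128 : ZMod p) ≠ 0 := by
  have h2 := two_ne_zero_zmod (p := p) hp2
  have : (128 : ZMod p) = 2 ^ 7 := by norm_num
  rw [this]; exact pow_ne_zero _ h2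

/-- **Lemma A** (`p ∤ k₀`): if `p ∣ Δ(k)` then every value of `Q_k` prime to `p` has Legendre symbol
`(2k₀/p)` (`Q_k ≡ (128k₀)⁻¹ ℓ²`, `128 = 2 · 8²`). [folklore] -/
theorem jacobiSym_binValK_of_not_dvd (hp2 : p ≠ 2) {k : Fin 3 → ℤ} (hn : (p : ℤ) ∣ discK k)
    (hk0 : ¬ (p : ℤ) ∣ k 0) {s t : ℤ} (hval : ¬ (p : ℤ) ∣ binValK k s t) :
    jacobiSym (binValK k s t) p = jacobiSym (2 * k 0) p := by
  rw [jacobiSym_eq_quadraticChar, jacobiSym_eq_quadraticChar]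
  have hnz : ((discK k : ℤ) : ZMod p) = 0 := (intCast_zmod_eq_zero_iff _).mpr hn
  have hk0' : ((k 0 : ℤ) : ZMod p) ≠ 0 := fun h ↦ hk0 ((intCast_zmod_eq_zero_iff _).mp h)
  have hval' : ((binValK k s t : ℤ) : ZMod p) ≠ 0 := fun h ↦ hval ((intCast_zmod_eq_zero_iff _).mp h)
  have h2 := two_ne_zero_zmod (p := p) hp2
  have key : (64 : ZMod p) * ((2 : ZMod p) * (k 0 : ℤ)) * (binValK k s t : ℤ) =
      ((64 * k 0 * s + k 1 * t : ℤ) : ZMod p) ^ 2 := by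
    have := congrArg (fun z : ℤ ↦ (z : ZMod p)) (mul_binValK_eq k s t)
    push_cast at this ⊢
    linear_combination this - (t : ZMod p) ^ 2 * hnz
  have h64 : (64 : ZMod p) ≠ 0 := by
    have : (64 : ZMod p) = 2 ^ 6 := by norm_num
    rw [this]; exact pow_ne_zero _ h2
  have h2k : (2 : ZMod p) * ((k 0 : ℤ) : ZMod p) ≠ 0 := mul_ne_zero h2 hk0'
  have hL : ((64 * k 0 * s + k 1 * t : ℤ) : ZMod p) ≠ 0 := by
    intro h0
    rw [h0, zero_pow two_ne_zero] at key
    rcases mul_eq_zero.mp key with h1 | h1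
    · rcases mul_eq_zero.mp h1 with h3 | h3
      · exact h64 h3
      · exact h2k h3
    · exact hval' h1
  have hsq : quadraticChar (ZMod p) (((64 * k 0 * s + k 1 * t : ℤ) : ZMod p) ^ 2) = 1 :=
    quadraticChar_sq_one' hL
  rw [← key, map_mul, map_mul] at hsq
  have h64sq : quadraticChar (ZMod p) (64 : ZMod p) = 1 := by
    have : (64 : ZMod p) = 8 ^ 2 := by norm_num
    rw [this]
    exact quadraticChar_sq_one' (by
      intro h8
      apply h64
      have : (64 : ZMod p) = 8 * 8 := by norm_num
      rw [this, h8, mul_zero])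
  rw [h64sq, one_mul] at hsq
  push_cast
  rcases quadraticChar_dichotomy h2k with h1 | h1
  · rw [h1, one_mul] at hsq; rw [hsq, h1]
  · rw [h1] at hsq ⊢
    linear_combination -hsq

/-- In the situation of Lemma A, `p ∣ Q_k(s,t)` forces `p ∣ ℓ(s,t) = 64k₀s + k₁t`. [folklore] -/
theorem dvd_lin_of_dvd_binValK {k : Fin 3 → ℤ} (hn : (p : ℤ) ∣ discK k)
    {s t : ℤ} (hval : (p : ℤ) ∣ binValK k s t) : (p : ℤ) ∣ 64 * k 0 * s + k 1 * t := by
  rw [← intCast_zmod_eq_zero_iff] at hval hn ⊢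
  have key : ((64 * k 0 * s + k 1 * t : ℤ) : ZMod p) ^ 2 = 0 := by
    have := congrArg (fun z : ℤ ↦ (z : ZMod p)) (mul_binValK_eq k s t)
    push_cast at this hval hn ⊢
    rw [hval, hn] at this
    linear_combination -this
  exact pow_eq_zero_iff two_ne_zero |>.mp key

/-- **Lemma B** (`p ∣ k₀`): then `p ∣ k₁`. [folklore] -/
theorem dvd_one_of_dvd_zeroK {k : Fin 3 → ℤ} (hn : (p : ℤ) ∣ discK k)
    (hk0 : (p : ℤ) ∣ k 0) : (p : ℤ) ∣ k 1 := by
  rw [← intCast_zmod_eq_zero_iff] at hn hk0 ⊢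
  unfold discK at hn
  push_cast at hn
  rw [hk0, mul_zero, zero_mul, sub_zero] at hn
  exact pow_eq_zero_iff two_ne_zero |>.mp hn

/-- `Q_k(s,t) ≡ k₂ t² (mod p)` when `p ∣ Δ(k)`, `p ∣ k₀`. [folklore] -/
theorem binValK_modEq_of_dvd_zero {k : Fin 3 → ℤ} (hn : (p : ℤ) ∣ discK k)
    (hk0 : (p : ℤ) ∣ k 0) (s t : ℤ) : binValK k s t ≡ k 2 * t ^ 2 [ZMOD p] := by
  have hk1 := dvd_one_of_dvd_zeroK hn hk0
  unfold binValK
  have h1 : 32 * k 0 * s ^ 2 ≡ 0 [ZMOD p] :=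
    Int.modEq_zero_iff_dvd.mpr (dvd_mul_of_dvd_left (dvd_mul_of_dvd_right hk0 _) _)
  have h2 : k 1 * s * t ≡ 0 [ZMOD p] :=
    Int.modEq_zero_iff_dvd.mpr (dvd_mul_of_dvd_left (dvd_mul_of_dvd_left hk1 _) _)
  have := (h1.add h2).add (Int.ModEq.refl (k 2 * t ^ 2))
  simpa using this

/-- **Lemmas A and B together**: for an odd prime `p ∣ Δ(k)` and any value `r = Q_k(s,t)` prime to
`p`, `kohnenSym p k = (r/p)`. [folklore] -/
theorem kohnenSym_eq_jacobiSym_binValK (hp2 : p ≠ 2) {k : Fin 3 → ℤ} (hn : (p : ℤ) ∣ discK k)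
    {s t : ℤ} (hval : ¬ (p : ℤ) ∣ binValK k s t) : kohnenSym p k = jacobiSym (binValK k s t) p := by
  unfold kohnenSym
  rw [if_pos hn]
  by_cases h0 : (p : ℤ) ∣ k 0
  · rw [if_pos h0]
    have hmod := binValK_modEq_of_dvd_zero hn h0 s t
    have ht : ¬ (p : ℤ) ∣ t := by
      intro ht
      exact hval ((dvd_iff_of_modEq hmod).mpr (dvd_mul_of_dvd_right (dvd_pow ht two_ne_zero) _))
    rw [jacobiSym.mod_left' hmod, jacobiSym_mul_sq ht]
  · rw [if_neg h0, jacobiSym_binValK_of_not_dvd hp2 hn h0 hval]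

/-- **`kohnenSym p` is `Γ₀(32)`-invariant**: `kohnenSym p (Q_k ∘ g) = kohnenSym p (Q_k)` for
`g = (a b; 32c' d) ∈ SL₂(ℤ)` and `p` an odd prime. [folklore] -/
theorem kohnenSym_actSharp32 (hp2 : p ≠ 2) {a b c' d : ℤ} (hdet : a * d - 32 * b * c' = 1)
    (k : Fin 3 → ℤ) : kohnenSym p (actSharp32 a b c' d k) = kohnenSym p k := by
  have hΔ := discK_actSharp32 hdet k
  by_cases hn : (p : ℤ) ∣ discK k
  swap
  · rw [kohnenSym_of_not_dvd hn, kohnenSym_of_not_dvd (by rwa [hΔ])]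
  have hn' : (p : ℤ) ∣ discK (actSharp32 a b c' d k) := by rwa [hΔ]
  set k' := actSharp32 a b c' d k with hk'
  have e0 : 32 * k' 0 = binValK k a (32 * c') := actSharp32_zero_eq a b c' d k
  have e2 : k' 2 = binValK k b d := actSharp32_two_eq a b c' d k
  have hp' : Prime (p : ℤ) := Nat.prime_iff_prime_int.mp hp.out
  have h32p : ¬ (p : ℤ) ∣ 32 := by
    intro h
    have : ((32 : ℤ) : ZMod p) = 0 := (intCast_zmod_eq_zero_iff _).mpr h
    exact c32_ne_zero_zmod (p := p) hp2 (by exact_mod_cast this)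
  have h2p : ¬ (p : ℤ) ∣ 2 := fun h ↦ h32p (dvd_trans h ⟨16, by norm_num⟩)
  have h4p : ¬ (p : ℤ) ∣ 4 := fun h ↦ h32p (dvd_trans h ⟨8, by norm_num⟩)
  -- `p ∣ k'₀ ↔ p ∣ Q_k(a, 32c')`
  have hdvd0 : (p : ℤ) ∣ k' 0 ↔ (p : ℤ) ∣ binValK k a (32 * c') := by
    rw [← e0]
    constructor
    · exact fun h ↦ dvd_mul_of_dvd_right h _
    · intro h
      exact (hp'.dvd_or_dvd h).resolve_left h32p
  -- the symbol of `k'` at its own values `k'₂ = Q_k(b,d)` and `32 k'₀ = Q_k(a, 32c')`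
  unfold kohnenSym
  rw [if_pos hn', if_pos hn]
  have hJ32 : jacobiSym (2 * k' 0) p = jacobiSym (32 * k' 0) p := by
    rw [show (32 : ℤ) * k' 0 = 2 * k' 0 * 4 ^ 2 by ring, jacobiSym_mul_sq h4p]
  by_cases hk0 : (p : ℤ) ∣ k 0
  · -- Lemma B regime
    rw [if_pos hk0]
    have hmod0 : binValK k a (32 * c') ≡ k 2 * (32 * c') ^ 2 [ZMOD p] :=
      binValK_modEq_of_dvd_zero hn hk0 a (32 * c')
    have hmod2 : k' 2 ≡ k 2 * d ^ 2 [ZMOD p] := by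
      rw [e2]; exact binValK_modEq_of_dvd_zero hn hk0 b d
    by_cases hk0' : (p : ℤ) ∣ k' 0
    · rw [if_pos hk0', jacobiSym.mod_left' hmod2]
      by_cases hk2 : (p : ℤ) ∣ k 2
      · rw [jacobiSym_eq_zero_of_dvd hk2, jacobiSym_eq_zero_of_dvd (dvd_mul_of_dvd_left hk2 _)]
      · have hvl := hdvd0.mp hk0'
        have h1 : (p : ℤ) ∣ k 2 * (32 * c') ^ 2 := (dvd_iff_of_modEq hmod0).mp hvl
        have hc' : (p : ℤ) ∣ c' := by
          rcases hp'.dvd_or_dvd h1 with h | h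
          · exact absurd h hk2
          · have h' := hp'.dvd_of_dvd_pow h
            rcases hp'.dvd_or_dvd h' with h'' | h''
            · exact absurd h'' h32p
            · exact h''
        have hd : ¬ (p : ℤ) ∣ d := by
          intro hd
          have : (p : ℤ) ∣ a * d - 32 * b * c' :=
            dvd_sub (dvd_mul_of_dvd_right hd _) (dvd_mul_of_dvd_right hc' _)
          rw [hdet] at this
          exact hp'.not_dvd_one this
        rw [jacobiSym_mul_sq hd]
    · rw [if_neg hk0']
      have hvl : ¬ (p : ℤ) ∣ binValK k a (32 * c') := fun h ↦ hk0' (hdvd0.mpr h)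
      have h1 : ¬ (p : ℤ) ∣ k 2 * (32 * c') ^ 2 := fun h ↦ hvl ((dvd_iff_of_modEq hmod0).mpr h)
      have hc32 : ¬ (p : ℤ) ∣ 32 * c' := fun h ↦ h1 (dvd_mul_of_dvd_right (dvd_pow h two_ne_zero) _)
      rw [hJ32, e0, jacobiSym.mod_left' hmod0, jacobiSym_mul_sq hc32]
  · -- Lemma A regime
    rw [if_neg hk0]
    by_cases hk0' : (p : ℤ) ∣ k' 0
    · rw [if_pos hk0', e2]
      apply jacobiSym_binValK_of_not_dvd hp2 hn hk0
      intro hbd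
      have hL1 := dvd_lin_of_dvd_binValK hn (hdvd0.mp hk0')
      have hL2 := dvd_lin_of_dvd_binValK hn hbd
      have : (p : ℤ) ∣ d * (64 * k 0 * a + k 1 * (32 * c')) - 32 * c' * (64 * k 0 * b + k 1 * d) :=
        dvd_sub (dvd_mul_of_dvd_right hL1 _) (dvd_mul_of_dvd_right hL2 _)
      have e : d * (64 * k 0 * a + k 1 * (32 * c')) - 32 * c' * (64 * k 0 * b + k 1 * d) =
          64 * k 0 * (a * d - 32 * b * c') := by ring
      rw [e, hdet, mul_one] at this
      rcases hp'.dvd_or_dvd this with h | h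
      · exact absurd (dvd_trans h ⟨2, by norm_num⟩ : (p : ℤ) ∣ 128)
          (fun h128 ↦ h2p (hp'.dvd_of_dvd_pow (show (p : ℤ) ∣ 2 ^ 7 by norm_num; exact h128)))
      · exact absurd h hk0
    · rw [if_neg hk0']
      have hvl : ¬ (p : ℤ) ∣ binValK k a (32 * c') := fun h ↦ hk0' (hdvd0.mpr h)
      rw [hJ32, e0]
      exact jacobiSym_binValK_of_not_dvd hp2 hn hk0 hvl

end ConeLemmas

/-! ### The weight -/

/-- **Kohnen's genus weight** `χ_{D*}(Q_k) = ∏_{p ∣ D} kohnenSym p k` (`D` odd square-free).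
[folklore] -/
def kohnenWt (D : ℕ) (k : Fin 3 → ℤ) : ℤ := ∏ p ∈ D.primeFactors, kohnenSym p k

/-- `|kohnenWt D k| ≤ 1`. [folklore] -/
theorem abs_kohnenWt_le (D : ℕ) (k : Fin 3 → ℤ) : |kohnenWt D k| ≤ 1 := by
  unfold kohnenWt
  rw [Finset.abs_prod]
  exact Finset.prod_le_one (fun _ _ ↦ abs_nonneg _) fun p _ ↦ abs_kohnenSym_le p k

/-- The weight vanishes unless `D ∣ Δ(k)` (`D` square-free). [folklore] -/
theorem kohnenWt_of_not_dvd {D : ℕ} (hD : Squarefree D) {k : Fin 3 → ℤ} (h : ¬ (D : ℤ) ∣ discK k) :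
    kohnenWt D k = 0 := by
  have : ∃ p ∈ D.primeFactors, ¬ (p : ℤ) ∣ discK k := by
    by_contra hall
    push Not at hall
    apply h
    have e : ((D : ℕ) : ℤ) = ∏ p ∈ D.primeFactors, (p : ℤ) := by
      conv_lhs => rw [← Nat.prod_primeFactors_of_squarefree hD]
      push_cast
      rfl
    rw [e]
    refine Finset.prod_dvd_of_coprime ?_ hall
    intro p hp q hq hpq
    have hpp := Nat.prime_of_mem_primeFactors (Finset.mem_coe.mp hp)
    have hqq := Nat.prime_of_mem_primeFactors (Finset.mem_coe.mp hq)
    exact Int.isCoprime_iff_gcd_eq_one.mpr (by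
      rw [Int.gcd_natCast_natCast]; exact (Nat.coprime_primes hpp hqq).mpr hpq)
  obtain ⟨p, hp, hpn⟩ := this
  unfold kohnenWt
  exact Finset.prod_eq_zero hp (kohnenSym_of_not_dvd hpn)

/-- **`kohnenWt D` is `Γ₀(32)`-invariant** (`D` odd). [folklore] -/
theorem kohnenWt_actSharp32 {D : ℕ} (hDodd : Odd D) {a b c' d : ℤ}
    (hdet : a * d - 32 * b * c' = 1) (k : Fin 3 → ℤ) :
    kohnenWt D (actSharp32 a b c' d k) = kohnenWt D k := by
  unfold kohnenWt
  refine Finset.prod_congr rfl fun p hp ↦ ?_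
  have hpp := Nat.prime_of_mem_primeFactors hp
  haveI := Fact.mk hpp
  have hp2 : p ≠ 2 := by
    rintro rfl
    exact (Nat.not_even_iff_odd.mpr hDodd) (even_iff_two_dvd.mpr (Nat.dvd_of_mem_primeFactors hp))
  exact kohnenSym_actSharp32 hp2 hdet k

/-- The complex-valued weight is an invariant weight in the sense of `Shintani32Kernel`. [folklore] -/
theorem invWeight32_kohnenWt {D : ℕ} (hD : Odd D) : InvWeight32 (fun k ↦ (kohnenWt D k : ℂ)) := by
  intro a b c' d hdet k
  simp only [kohnenWt_actSharp32 hD hdet]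

/-- The complex-valued weight is bounded. [folklore] -/
theorem bddWeight_kohnenWt (D : ℕ) : BddWeight (fun k ↦ (kohnenWt D k : ℂ)) :=
  ⟨1, fun k ↦ by
    rw [Complex.norm_intCast]
    exact_mod_cast abs_kohnenWt_le D k⟩

/-! ### Congruences, scaling, parity -/

/-- `kohnenSym p` depends only on `k` modulo `p`. [folklore] -/
theorem kohnenSym_congr {p : ℕ} {M : ℤ} (hpM : (p : ℤ) ∣ M) {k u : Fin 3 → ℤ}
    (h : ∀ i, k i ≡ u i [ZMOD M]) : kohnenSym p k = kohnenSym p u := by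
  have h' : ∀ i, k i ≡ u i [ZMOD p] := fun i ↦ (h i).of_dvd hpM
  have hn : ((p : ℤ) ∣ discK k) ↔ (p : ℤ) ∣ discK u :=
    dvd_iff_of_modEq (discK_emod_congr h')
  unfold kohnenSym
  by_cases hk : (p : ℤ) ∣ discK k
  · rw [if_pos hk, if_pos (hn.mp hk)]
    by_cases h0 : (p : ℤ) ∣ k 0
    · rw [if_pos h0, if_pos ((dvd_iff_of_modEq (h' 0)).mp h0)]
      exact jacobiSym.mod_left' (h' 2)
    · rw [if_neg h0, if_neg (fun hh ↦ h0 ((dvd_iff_of_modEq (h' 0)).mpr hh))]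
      exact jacobiSym.mod_left' ((Int.ModEq.refl 2).mul (h' 0))
  · rw [if_neg hk, if_neg (fun hh ↦ hk (hn.mpr hh))]

/-- **Periodicity**: `kohnenWt D` depends only on `k` modulo any multiple of `D`. [folklore] -/
theorem kohnenWt_congr {D : ℕ} {M : ℤ} (hDM : (D : ℤ) ∣ M) {k u : Fin 3 → ℤ}
    (h : ∀ i, k i ≡ u i [ZMOD M]) : kohnenWt D k = kohnenWt D u := by
  unfold kohnenWt
  refine Finset.prod_congr rfl fun p hp ↦ ?_
  exact kohnenSym_congr (dvd_trans (Int.natCast_dvd_natCast.mpr (Nat.dvd_of_mem_primeFactors hp)) hDM) h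

/-- **Scaling**: `kohnenSym p (t k) = (t/p) kohnenSym p k` for a prime `p`. [folklore] -/
theorem kohnenSym_smul {p : ℕ} (hp : p.Prime) (t : ℤ) (k : Fin 3 → ℤ) :
    kohnenSym p (t • k) = jacobiSym t p * kohnenSym p k := by
  haveI := Fact.mk hp
  have hp' : Prime (p : ℤ) := Nat.prime_iff_prime_int.mp hp
  unfold kohnenSym
  rw [discK_smul]
  simp only [Pi.smul_apply, smul_eq_mul]
  by_cases ht : (p : ℤ) ∣ t
  · have hJ : jacobiSym t p = 0 := jacobiSym_eq_zero_of_dvd ht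
    rw [hJ, zero_mul]
    split_ifs with h1 h2
    · exact jacobiSym_eq_zero_of_dvd (dvd_mul_of_dvd_left ht _)
    · rw [show (2 : ℤ) * (t * k 0) = t * (2 * k 0) by ring]
      exact jacobiSym_eq_zero_of_dvd (dvd_mul_of_dvd_left ht _)
    · rfl
  · have e1 : ((p : ℤ) ∣ t ^ 2 * discK k) ↔ (p : ℤ) ∣ discK k := by
      constructor
      · intro h
        rcases hp'.dvd_or_dvd h with h | h
        · exact absurd (hp'.dvd_of_dvd_pow h) ht
        · exact h
      · exact fun h ↦ dvd_mul_of_dvd_right h _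
    have e2 : ((p : ℤ) ∣ t * k 0) ↔ (p : ℤ) ∣ k 0 := by
      constructor
      · intro h
        rcases hp'.dvd_or_dvd h with h | h
        · exact absurd h ht
        · exact h
      · exact fun h ↦ dvd_mul_of_dvd_right h _
    by_cases hn : (p : ℤ) ∣ discK k
    · rw [if_pos (e1.mpr hn), if_pos hn]
      by_cases h0 : (p : ℤ) ∣ k 0
      · rw [if_pos (e2.mpr h0), if_pos h0, jacobiSym.mul_left]
      · rw [if_neg (mt e2.mp h0), if_neg h0, show (2 : ℤ) * (t * k 0) = t * (2 * k 0) by ring,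
          jacobiSym.mul_left]
    · rw [if_neg (mt e1.mp hn), if_neg hn, mul_zero]

/-- **Scaling of the weight**: `kohnenWt D (t k) = (t/D) kohnenWt D k` (`D` square-free). [folklore] -/
theorem kohnenWt_smul {D : ℕ} (hD : Squarefree D) (t : ℤ) (k : Fin 3 → ℤ) :
    kohnenWt D (t • k) = jacobiSym t D * kohnenWt D k := by
  unfold kohnenWt
  rw [Finset.prod_congr rfl fun p hp ↦ kohnenSym_smul (Nat.prime_of_mem_primeFactors hp) t k,
    Finset.prod_mul_distrib, ← jacobiSym_eq_prod_primeFactors hD]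

/-- **Parity**: `kohnenWt D (-k) = (-1/D) kohnenWt D k`; so the weight is odd exactly for
`D ≡ 3 (mod 4)`. [folklore] -/
theorem kohnenWt_neg {D : ℕ} (hD : Squarefree D) (k : Fin 3 → ℤ) :
    kohnenWt D (-k) = jacobiSym (-1) D * kohnenWt D k := by
  rw [show -k = (-1 : ℤ) • k by simp, kohnenWt_smul hD]

/-- For `D ≡ 3 (mod 4)` square-free the weight is odd: `kohnenWt D (-k) = -kohnenWt D k`. [folklore] -/
theorem kohnenWt_neg_of_mod_four_eq_three {D : ℕ} (hD : Squarefree D) (hD3 : D % 4 = 3)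
    (k : Fin 3 → ℤ) : kohnenWt D (-k) = -kohnenWt D k := by
  have hodd : Odd D := Nat.odd_iff.mpr (by omega)
  rw [kohnenWt_neg hD, jacobiSym.at_neg_one hodd, ZMod.χ₄_nat_mod_four, hD3]
  simp

end Literature.NumberTheory.EllipticCurves.Shintani
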